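import Summits.ABC.ABC.Theses.IsogenyGlueCongruence
import Summits.ABC.ABC.Theorems.TwistAmplificationSomeWindowSavingZagierSilvermanBridgeSemistable
import Literature.NumberTheory.EllipticCurves.SzpiroFreyCurveProofs
import HarnessLib

/-!
# Route IsogenyGlueCongruence — support `PolyAbcOfPolyDegree` (stmt-ABC-2048): what is provable

The item asks: a POLYNOMIAL modular-degree bound `deg φ ≤ C · N^κ` for the SEMISTABLE elliptic
curves over `ℚ` in global minimal form implies polynomial abc for ALL abc triples
(`Literature.Barriers.ABC.BakerShapeBound 0 1`: `∃ κ', log c ≤ κ' · log rad(abc)`).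

Kernel-checked here, from PROVED tree inputs only (Zagier's identity, Pasten's trivial Petersson
bound, Silverman's covolume inequality — packaged as
`Summit.ABC.ABC.Theorems.stub_zagierSilvermanBridgeSemistable` /
`Summit.ABC.ABC.Theorems.weakGenSzpiro_of_polyDegreeAll` — and the Frey-curve facts of
Bombieri–Gubler Ex. 12.5.10, `exists_arrangement`, `freyIntModel₂`, `exists_minimal_frey_model`):

* `PolyAbc.log_le_of_pow_six_le`, `PolyAbc.pow_six_le_of_c4` — real-arithmetic bookkeeping with a
  FIXED exponent (`c⁶ ≤ M R^e`, `R ≥ 2` ⟹ `log c ≤ κ log R`).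
* `PolyAbc.log_le_of_minimal_model` — one abc triple with a minimal integral Frey model `W₀`
  (`cond ∣ 2¹⁰ rad`, `c² ≤ 2|c₄|`) and a weak generalized Szpiro inequality
  `max(|Δ|,|c₄|³) ≤ C N^K` for it: `log c ≤ κ(K, C) · log rad(abc)`.
* `polyAbcSixteen_of_weakGenSzpiroSemistable`, `polyAbcSixteen_of_polyDegree` — the filed
  hypothesis DOES give polynomial abc for the triples with `16 ∣ abc` (their normalised Frey curve
  (12.18) is semistable).
* `bakerShapeBound_zero_one_of_weakGenSzpiro`, `bakerShapeBound_zero_one_of_polyDegreeAll` — the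
  same conclusion for ALL triples from the hypothesis with semistability DROPPED (the Frey curve
  (12.17) of a triple with `16 ∤ abc` has additive reduction at `2`, conductor `∣ 2¹⁰ rad`).
* `polySzpiroSemistable_of_polyDegree` — inside the semistable world the filed hypothesis means
  polynomial generalized Szpiro: `max(|Δ_min|, |c₄|³) ≤ C · N^K` for semistable curves.
* `polyAbcOfPolyDegree_of_transfer` — the item as filed, CONDITIONAL on the one missing step: a
  transfer of polynomial abc from the triples with `16 ∣ abc` to all triples;
  `polyAbcOfPolyDegree_of_polyDegreeAll` — the item as filed from the all-curves hypothesis.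

Why the transfer is missing (release note of the item): the route's suggested normalisation
`(u⁸, v⁸ − u⁸, v⁸)` on the two odd members has `c' ≥ (c/2)⁸` but only `rad' ≤ 8 c⁷ rad(abc)`
(`Literature.NumberTheory.DiophantineGeometry.isABCTriple_pow_eight`), so `c' ≤ M rad'^e` yields
`(8 − 7e) log c ≤ O(1) + e log rad` — informative only for `e < 8/7`
(`DiophantineGeometry.le_of_pow_eight_le` needs `7ε' < 1`), while a fixed polynomial exponent gives
`e ≈ κ ≥ 8/7`. Every identity-based normalisation of degree `n` loses `c^{n−1}` in the radical
(Mason–Stothers), so none works for `e ≥ 2`; and the Frey curve of a triple with `16 ∤ abc` is not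
semistable at `2` (nor is any quadratic twist in general, e.g. `1 + 1 = 2` gives `y² = x³ − x`).
Lands `--supports stmt-ABC-2048`.

Maintenance record (full-build repair, 2026-08-16). Route rev 18 (2026-08-16T14:44:06Z, right-size)
dropped the Theses decl `PolyAbcOfPolyDegree` (stmt-ABC-2048, verdict misstated ×3, closed `moot`)
from the gate-written `Summits/ABC/ABC/Theses/IsogenyGlueCongruence.lean`, while this append-only
file (and `…PolyAbcOfPolyDegreeResidual.lean`, which imports it) still names it ("Unknown
identifier" in the full build of 2026-08-16T23:32Z). The dropped constant is therefore re-declared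
below under its original fully-qualified name (NOT a route item), ledger signature verbatim — the
same repair as `IsogenyGlueCongruenceDegreePrimesOfCongruenceBound.lean`. Every theorem, its name,
its statement text and its proof script are unchanged.
-/

noncomputable section

open IsDedekindDomain WeierstrassCurve
open Literature.NumberTheory.EllipticCurves
open Literature.NumberTheory.EllipticCurves.ModularForms
open Literature.NumberTheory.DiophantineGeometry (IsABCTriple rad rad_def)
open Literature.Barriers.ABC (BakerShapeBound)

-- `Summit.<Summit>.<Problem>` is the mandated summit-side namespace (CONVENTIONS §2); for the
-- single-conjunct summit `ABC` the two coincide, so the duplicate `ABC.ABC` is deliberate.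
set_option linter.dupNamespace false

namespace Summit.ABC.ABC.Theses.IsogenyGlueCongruence

/-- **Record of the dropped route item `PolyAbcOfPolyDegree`** = stmt-ABC-2048 (support item of
route `IsogenyGlueCongruence`; verdict `misstated` ×3 — see `polyAbcOfPolyDegree_of_transfer` below
and `polyAbcOfPolyDegree_iff_residual` —, closed `moot` and dropped from the route file at rev 18,
2026-08-16T14:44:06Z; NOT a route item): a polynomial modular-degree bound `deg φ ≤ C · N^κ` for the
SEMISTABLE elliptic curves over `ℚ` in global minimal form implies polynomial abc for ALL abc
triples, `Literature.Barriers.ABC.BakerShapeBound 0 1` (`∃ κ', log c ≤ κ' · log rad(abc)`).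
Re-declared under its original fully-qualified name, ledger signature verbatim, solely so that this
append-only record keeps elaborating (untagged on purpose: it is a record of OUR dropped item,
not a literature fact); never asserted — it occurs below only as the conclusion of conditional
theorems. -/
def PolyAbcOfPolyDegree : Prop :=
  (∃ κ C : ℝ, ∀ (W : WeierstrassCurve ℚ) [W.IsElliptic] [W.IsGloballyMinimal] [NeZero (W.conductorNorm ℤ)], W.IsSemistable ℤ → ∃ D : Literature.NumberTheory.EllipticCurves.ModularForms.ModularParametrizationData W (W.conductorNorm ℤ), (D.modularDegree : ℝ) ≤ C * (W.conductorNorm ℤ : ℝ) ^ κ) → Literature.Barriers.ABC.BakerShapeBound 0 1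

end Summit.ABC.ABC.Theses.IsogenyGlueCongruence

namespace Summit.ABC.ABC.Theorems

/-! ### Real-arithmetic bookkeeping with a fixed exponent -/

/-- From `c⁶ ≤ M · R^e` with `c > 0`, `M ≥ 1`, `R ≥ 2` (`R^e` the real power):
`log c ≤ ((log M / log 2 + e) / 6) · log R` (use `log M ≤ (log M / log 2) · log R`). [folklore] -/
theorem PolyAbc.log_le_of_pow_six_le {c M R e : ℝ} (hc : 0 < c) (hM : 1 ≤ M) (hR : 2 ≤ R)
    (h : c ^ 6 ≤ M * R ^ e) :
    Real.log c ≤ (Real.log M / Real.log 2 + e) / 6 * Real.log R := by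
  have hR0 : 0 < R := by linarith
  have hlog2 : 0 < Real.log 2 := Real.log_pos one_lt_two
  have hlogR : Real.log 2 ≤ Real.log R := Real.log_le_log two_pos hR
  have hlogM : 0 ≤ Real.log M := Real.log_nonneg hM
  have h1 : 6 * Real.log c ≤ Real.log M + e * Real.log R := by
    have h' := Real.log_le_log (by positivity) h
    rw [Real.log_pow, Real.log_mul (by positivity) (by positivity), Real.log_rpow hR0] at h'
    push_cast at h'
    exact h'
  have h2 : Real.log M ≤ Real.log M / Real.log 2 * Real.log R := by
    rw [div_mul_eq_mul_div, le_div_iff₀ hlog2]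
    exact mul_le_mul_of_nonneg_left hlogR hlogM
  have h3 : (Real.log M / Real.log 2 + e) / 6 * Real.log R =
      (Real.log M / Real.log 2 * Real.log R + e * Real.log R) / 6 := by ring
  rw [h3]
  linarith

/-- From `c² ≤ 2|c₄|`, `|c₄|³ ≤ C · N^K` and `1 ≤ N ≤ 2¹⁰ R`:
`c⁶ ≤ 8 · max(C,1) · (2¹⁰)^{max(K,0)} · R^{max(K,0)}`. [folklore] -/
theorem PolyAbc.pow_six_le_of_c4 {c c₄ C N K R : ℝ} (hN : 1 ≤ N) (hR : 0 ≤ R)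
    (hNR : N ≤ 2 ^ 10 * R) (hc : c ^ 2 ≤ 2 * |c₄|) (hc₄ : |c₄| ^ 3 ≤ C * N ^ K) :
    c ^ 6 ≤ 8 * max C 1 * (2 ^ 10) ^ (max K 0) * R ^ (max K 0) := by
  have hN0 : 0 ≤ N := zero_le_one.trans hN
  have hC1 : 0 ≤ max C 1 := zero_le_one.trans (le_max_right _ _)
  have hK : N ^ K ≤ N ^ (max K 0) := Real.rpow_le_rpow_of_exponent_le hN (le_max_left _ _)
  have h1 : |c₄| ^ 3 ≤ max C 1 * N ^ (max K 0) :=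
    calc |c₄| ^ 3 ≤ C * N ^ K := hc₄
      _ ≤ max C 1 * N ^ K := mul_le_mul_of_nonneg_right (le_max_left _ _) (Real.rpow_nonneg hN0 _)
      _ ≤ max C 1 * N ^ (max K 0) := mul_le_mul_of_nonneg_left hK hC1
  have h2 : N ^ (max K 0) ≤ (2 ^ 10 * R) ^ (max K 0) :=
    Real.rpow_le_rpow hN0 hNR (le_max_right _ _)
  have h3 : (2 ^ 10 * R : ℝ) ^ (max K 0) = (2 ^ 10) ^ (max K 0) * R ^ (max K 0) :=
    Real.mul_rpow (by positivity) hR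
  have h4 : max C 1 * N ^ (max K 0) ≤ max C 1 * ((2 ^ 10) ^ (max K 0) * R ^ (max K 0)) :=
    mul_le_mul_of_nonneg_left (h3 ▸ h2) hC1
  calc c ^ 6 = (c ^ 2) ^ 3 := by ring
    _ ≤ (2 * |c₄|) ^ 3 := pow_le_pow_left₀ (sq_nonneg c) hc 3
    _ = 8 * |c₄| ^ 3 := by ring
    _ ≤ 8 * (max C 1 * N ^ (max K 0)) := by linarith
    _ ≤ 8 * (max C 1 * ((2 ^ 10) ^ (max K 0) * R ^ (max K 0))) := by linarith
    _ = _ := by ring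

/-! ### One triple with a minimal Frey model -/

/-- **One abc triple, one minimal integral model.** If an abc triple `(a, b, c)` carries an integral
Weierstrass model `W₀` with `W₀ ⊗ ℚ` elliptic, `cond(W₀ ⊗ ℚ) ∣ 2¹⁰ rad(abc)` and `c² ≤ 2|c₄(W₀)|`
(the Frey models (12.17)/(12.18), `exists_minimal_frey_model`), and `W₀` satisfies the weak
generalized Szpiro inequality `max(|Δ|, |c₄|³) ≤ C · N^K`, then
`log c ≤ κ(K, C) · log rad(abc)` with
`κ(K, C) = (log(8 max(C,1) 2^{10 max(K,0)}) / log 2 + max(K,0)) / 6` (the radical of an abc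
triple is `≥ 2`). Bombieri–Gubler, proof of Thm. 12.5.12 (c) ⟹ (a), with a fixed exponent.
[folklore] -/
theorem PolyAbc.log_le_of_minimal_model {K C : ℝ} {a b c : ℕ} (h : IsABCTriple a b c)
    (W₀ : WeierstrassCurve ℤ) [(W₀.baseChange ℚ).IsElliptic]
    (hN : (W₀.baseChange ℚ).conductorNorm ℤ ∣ 2 ^ 10 * rad a b c)
    (hc₄ : (c : ℤ) ^ 2 ≤ 2 * |W₀.c₄|)
    (key : ((max |W₀.Δ| (|W₀.c₄| ^ 3) : ℤ) : ℝ) ≤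
      C * (((W₀.baseChange ℚ).conductorNorm ℤ : ℕ) : ℝ) ^ K) :
    Real.log c ≤ (Real.log (8 * max C 1 * (2 ^ 10) ^ (max K 0)) / Real.log 2 + max K 0) / 6 *
      Real.log (rad a b c : ℕ) := by
  obtain ⟨ha, hb, habc, -⟩ := h
  have hc0 : 0 < c := by omega
  set N : ℝ := (((W₀.baseChange ℚ).conductorNorm ℤ : ℕ) : ℝ) with hNdef
  set R : ℝ := ((rad a b c : ℕ) : ℝ) with hRdef
  have hradpos : 0 < rad a b c := by rw [rad_def]; exact Nat.radical_pos _
  have hR2 : (2 : ℝ) ≤ R := by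
    have h2 : 2 ≤ rad a b c := by
      rw [rad_def, Nat.two_le_radical_iff]
      calc 2 ≤ c := by omega
        _ ≤ a * b * c := Nat.le_mul_of_pos_left c (Nat.mul_pos ha hb)
    rw [hRdef]; exact_mod_cast h2
  have hR0 : (0 : ℝ) ≤ R := by linarith
  have hN1 : (1 : ℝ) ≤ N := by
    rw [hNdef]; exact_mod_cast conductorNorm_pos_holds (W₀.baseChange ℚ)
  have hNR : N ≤ 2 ^ 10 * R := by
    have := Nat.le_of_dvd (mul_pos (by positivity) hradpos) hN
    rw [hNdef, hRdef]; exact_mod_cast this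
  -- `|c₄|³ ≤ C N^K` and `c² ≤ 2|c₄|` over `ℝ`
  have h1 : |(W₀.c₄ : ℝ)| ^ 3 ≤ C * N ^ K :=
    le_of_max_le_right (by simpa [Int.cast_max, Int.cast_abs, Int.cast_pow] using key)
  have h2 : (c : ℝ) ^ 2 ≤ 2 * |(W₀.c₄ : ℝ)| := by exact_mod_cast hc₄
  -- `c⁶ ≤ M R^{max K 0}` and logarithms
  have h6 := PolyAbc.pow_six_le_of_c4 hN1 hR0 hNR h2 h1
  have hM : (1 : ℝ) ≤ 8 * max C 1 * (2 ^ 10) ^ (max K 0) := by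
    have hC1 : (1 : ℝ) ≤ max C 1 := le_max_right _ _
    have hp : (1 : ℝ) ≤ (2 ^ 10 : ℝ) ^ (max K 0) := Real.one_le_rpow (by norm_num) (le_max_right _ _)
    nlinarith
  exact PolyAbc.log_le_of_pow_six_le (by exact_mod_cast hc0) hM hR2 h6

/-! ### Polynomial abc for the triples with `16 ∣ abc` from the semistable hypothesis -/

/-- **Weak generalized Szpiro for semistable minimal models ⟹ polynomial abc on the triples with
`16 ∣ abc`.** If `max(|Δ|, |c₄|³) ≤ C · N^K` for every integral model, minimal at all places and
semistable, of an elliptic curve over `ℚ`, then there is `κ` with `log c ≤ κ · log rad(abc)` for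
every abc triple with `16 ∣ abc`: after Serre's arrangement (`exists_arrangement`: `A ≡ −1 (4)`,
`16 ∣ B`) the global minimal equation (12.18) `freyIntModel₂ A B` of the Frey curve is semistable
(`isSemistableAt_freyIntModel₂`), has conductor `∣ rad(abc)` (`conductorNorm_freyIntModel₂_dvd`)
and `c₄ = A² + AB + B² = (a² + b² + c²)/2 ≥ c²/2`. Bombieri–Gubler Ex. 12.5.10, Thm. 12.5.12.
[folklore] -/
theorem polyAbcSixteen_of_weakGenSzpiroSemistable
    (hSz : ∃ K C : ℝ, ∀ W₀ : WeierstrassCurve ℤ, (W₀.baseChange ℚ).IsElliptic →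
      (∀ v : HeightOneSpectrum ℤ, (W₀.baseChange ℚ).IsMinimalAt v) →
        (W₀.baseChange ℚ).IsSemistable ℤ →
          ((max |W₀.Δ| (|W₀.c₄| ^ 3) : ℤ) : ℝ) ≤
            C * (((W₀.baseChange ℚ).conductorNorm ℤ : ℕ) : ℝ) ^ K) :
    ∃ κ : ℝ, ∀ a b c : ℕ, IsABCTriple a b c → 16 ∣ a * b * c →
      Real.log c ≤ κ * Real.log (rad a b c : ℕ) := by
  obtain ⟨K, C, hSz⟩ := hSz
  refine ⟨(Real.log (8 * max C 1 * (2 ^ 10) ^ (max K 0)) / Real.log 2 + max K 0) / 6,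
    fun a b c h h16 ↦ ?_⟩
  have h' := h
  obtain ⟨ha, hb, habc, hcop⟩ := h'
  have hc0 : 0 < c := by omega
  have habc0 : a * b * c ≠ 0 := by positivity
  -- Serre's arrangement and the semistable global minimal equation (12.18)
  obtain ⟨A, B, hAB, hA4, hB, hprod, hquad⟩ := exists_arrangement h h16
  have h0 : A * B * (A + B) ≠ 0 := by
    rw [← Int.natAbs_ne_zero, hprod]; exact habc0
  have h4 : 4 ∣ B - A - 1 := by
    have : B - A - 1 = B - (A + 1) := by ring
    rw [this]; exact dvd_sub (dvd_trans (by norm_num) hB) hA4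
  have h16' : 16 ∣ A * B := dvd_mul_of_dvd_right hB _
  haveI hE : ((freyIntModel₂ A B).baseChange ℚ).IsElliptic := isElliptic_freyIntModel₂ h0 h4 h16'
  have hmin : ∀ v : HeightOneSpectrum ℤ, ((freyIntModel₂ A B).baseChange ℚ).IsMinimalAt v :=
    isMinimalAt_freyIntModel₂ hAB hA4 hB
  have hss : ((freyIntModel₂ A B).baseChange ℚ).IsSemistable ℤ := fun v ↦
    isSemistableAt_freyIntModel₂ hAB h0 hA4 hB v
  have key := hSz (freyIntModel₂ A B) hE hmin hss
  -- `cond ∣ rad(abc) ∣ 2¹⁰ rad(abc)` and `c² ≤ 2 c₄`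
  have hdvd : ((freyIntModel₂ A B).baseChange ℚ).conductorNorm ℤ ∣ 2 ^ 10 * rad a b c := by
    refine dvd_trans ?_ (dvd_mul_left _ _)
    rw [rad_def, ← hprod]
    exact conductorNorm_freyIntModel₂_dvd hAB h0 hA4 hB
  have hc₄ : (c : ℤ) ^ 2 ≤ 2 * |(freyIntModel₂ A B).c₄| := by
    rw [freyIntModel₂_c₄ h4 h16']
    have hq : (0 : ℤ) ≤ A ^ 2 + A * B + B ^ 2 := by
      nlinarith [sq_nonneg (A + B), sq_nonneg A, sq_nonneg B]
    rw [abs_of_nonneg hq, hquad]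
    nlinarith [sq_nonneg (a : ℤ), sq_nonneg (b : ℤ)]
  exact PolyAbc.log_le_of_minimal_model h (freyIntModel₂ A B) hdvd hc₄ key

/-- **The filed hypothesis gives polynomial abc on the triples with `16 ∣ abc`.** A polynomial
modular-degree bound `deg φ ≤ C · N^κ` for the semistable elliptic curves over `ℚ` in global minimal
form (VERBATIM the antecedent of `Summit.ABC.ABC.Theses.IsogenyGlueCongruence.PolyAbcOfPolyDegree`)
implies `∃ κ', log c ≤ κ' · log rad(abc)` for every abc triple with `16 ∣ abc`: Zagier's identity,
Pasten's trivial Petersson bound and Silverman's covolume inequality (all proved;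
`stub_zagierSilvermanBridgeSemistable`) give weak generalized Szpiro for the semistable minimal
models, and `polyAbcSixteen_of_weakGenSzpiroSemistable` finishes. Frey 1989; Pasten
arXiv:1705.09251 §3; Silverman 1986 Cor. 2.3; Bombieri–Gubler Ex. 12.5.10. [folklore] -/
theorem polyAbcSixteen_of_polyDegree
    (hdeg : ∃ κ C : ℝ, ∀ (W : WeierstrassCurve ℚ) [W.IsElliptic] [W.IsGloballyMinimal]
      [NeZero (W.conductorNorm ℤ)], W.IsSemistable ℤ →
        ∃ D : ModularParametrizationData W (W.conductorNorm ℤ),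
          (D.modularDegree : ℝ) ≤ C * (W.conductorNorm ℤ : ℝ) ^ κ) :
    ∃ κ : ℝ, ∀ a b c : ℕ, IsABCTriple a b c → 16 ∣ a * b * c →
      Real.log c ≤ κ * Real.log (rad a b c : ℕ) :=
  polyAbcSixteen_of_weakGenSzpiroSemistable (stub_zagierSilvermanBridgeSemistable hdeg)

/-! ### Polynomial abc for all triples from the hypothesis without semistability -/

/-- The logarithmic form `∃ κ, log c ≤ κ · log rad(abc)` is `BakerShapeBound 0 1`
(`rad⁰ = 1`, `(log rad)¹ = log rad`). [folklore] -/
theorem PolyAbc.bakerShapeBound_zero_one_of_log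
    (h : ∃ κ : ℝ, ∀ a b c : ℕ, IsABCTriple a b c → Real.log c ≤ κ * Real.log (rad a b c : ℕ)) :
    BakerShapeBound 0 1 := by
  obtain ⟨κ, hκ⟩ := h
  refine ⟨κ, fun a b c habc ↦ ?_⟩
  rw [Real.rpow_zero, mul_one, pow_one]
  exact hκ a b c habc

/-- **Weak generalized Szpiro for all minimal models ⟹ polynomial abc** (Bombieri–Gubler,
Thm. 12.5.12 (c) ⟹ (a) with a fixed exponent): if `max(|Δ|, |c₄|³) ≤ C · N^K` for every integral
model, minimal at all places, of an elliptic curve over `ℚ`, then `BakerShapeBound 0 1`. Every abc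
triple has a minimal Frey model with `cond ∣ 2¹⁰ rad(abc)` and `c² ≤ 2|c₄|`
(`exists_minimal_frey_model`: (12.17) if `16 ∤ abc`, (12.18) if `16 ∣ abc`); conclude by
`PolyAbc.log_le_of_minimal_model`. [folklore] -/
theorem bakerShapeBound_zero_one_of_weakGenSzpiro
    (hSz : ∃ K C : ℝ, ∀ W₀ : WeierstrassCurve ℤ, (W₀.baseChange ℚ).IsElliptic →
      (∀ v : HeightOneSpectrum ℤ, (W₀.baseChange ℚ).IsMinimalAt v) →
        ((max |W₀.Δ| (|W₀.c₄| ^ 3) : ℤ) : ℝ) ≤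
          C * (((W₀.baseChange ℚ).conductorNorm ℤ : ℕ) : ℝ) ^ K) :
    BakerShapeBound 0 1 := by
  obtain ⟨K, C, hSz⟩ := hSz
  refine PolyAbc.bakerShapeBound_zero_one_of_log
    ⟨(Real.log (8 * max C 1 * (2 ^ 10) ^ (max K 0)) / Real.log 2 + max K 0) / 6,
      fun a b c h ↦ ?_⟩
  obtain ⟨W₀, hE, hmin, hN, hc₄⟩ := exists_minimal_frey_model h
  haveI := hE
  exact PolyAbc.log_le_of_minimal_model h W₀ hN hc₄ (hSz W₀ hE hmin)

/-- **The repaired statement, proved: polynomial modular degree for ALL elliptic curves over `ℚ`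
⟹ polynomial abc.** If there are `κ, C` such that every elliptic curve over `ℚ` in global minimal
form `W` admits at level `N = N_E` a modular parametrisation datum with `deg φ ≤ C · N^κ`
(the antecedent of `PolyAbcOfPolyDegree` with the restriction `W.IsSemistable ℤ` dropped), then
`BakerShapeBound 0 1` (`∃ κ', log c ≤ κ' log rad(abc)` for all abc triples). The Manin constant is
a non-zero integer (`maninConstant_ne_zero_holds`), so `deg ≤ max(C,0) · c² · N^κ`, the shape of
`weakGenSzpiro_of_polyDegreeAll` (Zagier + trivial Petersson + Silverman, proved); finish with
`bakerShapeBound_zero_one_of_weakGenSzpiro`. Frey 1989/1997 (degree conjecture ⟹ height conjecture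
⟹ abc-type inequality with the degree exponent); Murty 1999 Thm. 1; Pasten arXiv:1705.09251 §3.
[folklore] -/
theorem bakerShapeBound_zero_one_of_polyDegreeAll
    (hdeg : ∃ κ C : ℝ, ∀ (W : WeierstrassCurve ℚ) [W.IsElliptic] [W.IsGloballyMinimal]
      [NeZero (W.conductorNorm ℤ)],
        ∃ D : ModularParametrizationData W (W.conductorNorm ℤ),
          (D.modularDegree : ℝ) ≤ C * (W.conductorNorm ℤ : ℝ) ^ κ) :
    BakerShapeBound 0 1 := by
  obtain ⟨κ, C, hdeg⟩ := hdeg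
  refine bakerShapeBound_zero_one_of_weakGenSzpiro (weakGenSzpiro_of_polyDegreeAll ⟨κ, max C 0, ?_⟩)
  intro W _ _ _
  obtain ⟨D, hD⟩ := hdeg W
  refine ⟨D, ?_⟩
  have hc1 : (1 : ℝ) ≤ (D.c : ℝ) ^ 2 :=
    ZagierSilvermanBridge.one_le_cast_sq D.maninConstant_ne_zero_holds
  have hN0 : (0 : ℝ) ≤ ((W.conductorNorm ℤ : ℕ) : ℝ) ^ κ := by positivity
  calc (D.deg : ℝ) ≤ C * ((W.conductorNorm ℤ : ℕ) : ℝ) ^ κ := hD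
    _ ≤ max C 0 * ((W.conductorNorm ℤ : ℕ) : ℝ) ^ κ :=
        mul_le_mul_of_nonneg_right (le_max_left _ _) hN0
    _ = max C 0 * 1 * ((W.conductorNorm ℤ : ℕ) : ℝ) ^ κ := by ring
    _ ≤ max C 0 * (D.c : ℝ) ^ 2 * ((W.conductorNorm ℤ : ℕ) : ℝ) ^ κ :=
        mul_le_mul_of_nonneg_right (mul_le_mul_of_nonneg_left hc1 (le_max_right C 0)) hN0

/-! ### The meaning of the waypoint inside the semistable world: polynomial Szpiro -/

/-- **Polynomial modular degree ⟹ polynomial generalized Szpiro, semistable curves** (the third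
candidate repair of the item, entirely inside the route's semistable world): under the filed
antecedent there are `K, C` with `max(|Δ_min|, |c₄|³) ≤ C · N^K` for every semistable elliptic curve
over `ℚ` in global minimal form `W` (`Δ_W = Δ_min`). Proof: with `δ := max κ 3 − 2 ≥ 1` the datum `D`
of the antecedent has `deg ≤ max(C,1) · c² · N^{2+δ}` (`c ∈ ℤ ∖ {0}`, `maninConstant_ne_zero_holds`);
Zagier's identity with Pasten's trivial Petersson bound (`covolume_ge_of_deg_le`,
`murty_petersson_newform_lower_bound_of_one_le`, both proved) gives
`covol(Λ_E) ≥ (4π²c₂/max(C,1)) · N^{−(1+2δ)}`, and Silverman's covolume inequality at `ε = 1`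
(`silverman1986_discriminant_c4_covolume_holds`, proved) gives `max(|Δ|,|c₄|³) ≤ A · covol^{−7}`;
combine with `ZagierSilvermanBridge.le_of_covolume_estimates`. Frey 1989/1997 (degree conjecture ⟹
height conjecture); Pasten arXiv:1705.09251 §3; Silverman 1986 Cor. 2.3 with Prop. 1.1. [folklore] -/
theorem polySzpiroSemistable_of_polyDegree
    (hdeg : ∃ κ C : ℝ, ∀ (W : WeierstrassCurve ℚ) [W.IsElliptic] [W.IsGloballyMinimal]
      [NeZero (W.conductorNorm ℤ)], W.IsSemistable ℤ →
        ∃ D : ModularParametrizationData W (W.conductorNorm ℤ),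
          (D.modularDegree : ℝ) ≤ C * (W.conductorNorm ℤ : ℝ) ^ κ) :
    ∃ K C : ℝ, ∀ (W : WeierstrassCurve ℚ) [W.IsElliptic] [W.IsGloballyMinimal]
      [NeZero (W.conductorNorm ℤ)], W.IsSemistable ℤ →
        ((max |W.Δ| (|W.c₄| ^ 3) : ℚ) : ℝ) ≤ C * (W.conductorNorm ℤ : ℝ) ^ K := by
  obtain ⟨κ, C, hdeg⟩ := hdeg
  obtain ⟨δ, hδ1, hκδ⟩ : ∃ δ : ℝ, 1 ≤ δ ∧ κ ≤ 2 + δ :=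
    ⟨max κ 3 - 2, by have := le_max_right κ 3; linarith, by have := le_max_left κ 3; linarith⟩
  have hC₁ : (0 : ℝ) < max C 1 := one_pos.trans_le (le_max_right _ _)
  obtain ⟨c₂, hc₂, hP⟩ := murty_petersson_newform_lower_bound_of_one_le hδ1
  obtain ⟨A, hA⟩ := silverman1986_discriminant_c4_covolume_holds 1 one_pos
  have hκ₀ : 0 < 4 * Real.pi ^ 2 * c₂ / max C 1 := div_pos (by positivity) hC₁
  refine ⟨(1 + 2 * δ) * (6 + 1), max A 0 * (4 * Real.pi ^ 2 * c₂ / max C 1) ^ (-(6 + 1 : ℝ)),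
    fun W _ _ _ hss ↦ ?_⟩
  obtain ⟨D, hD⟩ := hdeg W hss
  have hN0 : 0 < W.conductorNorm ℤ := conductorNorm_pos_holds W
  have hN1 : (1 : ℝ) ≤ ((W.conductorNorm ℤ : ℕ) : ℝ) := by exact_mod_cast hN0
  have hNpos : (0 : ℝ) < ((W.conductorNorm ℤ : ℕ) : ℝ) := by exact_mod_cast hN0
  have hc1 : (1 : ℝ) ≤ (D.c : ℝ) ^ 2 :=
    ZagierSilvermanBridge.one_le_cast_sq D.maninConstant_ne_zero_holds
  have hD1 : (D.deg : ℝ) ≤ C * 1 * ((W.conductorNorm ℤ : ℕ) : ℝ) ^ κ := by rw [mul_one]; exact hD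
  have hD' := ZagierSilvermanBridge.deg_le_of_le hN1 zero_le_one hc1 hκδ hD1
  -- Zagier + trivial Petersson: the covolume from below; Silverman: the invariants from above
  have hlow := covolume_ge_of_deg_le D hC₁ hD' (hP _ W D.f D.isNewformOf)
  have hSW := hA W D.L D.isNeronLattice
  have hcov : 0 < ZLattice.covolume D.L.lattice := ZLattice.covolume_pos _ _
  exact ZagierSilvermanBridge.le_of_covolume_estimates hκ₀ hNpos hcov hSW hlow

/-! ### The item as filed, modulo the missing transfer -/

/-- **`PolyAbcOfPolyDegree` modulo the transfer `16 ∣ abc ⟹ all`.** The filed item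
`Summit.ABC.ABC.Theses.IsogenyGlueCongruence.PolyAbcOfPolyDegree` follows from ONE further
implication: polynomial abc on the abc triples with `16 ∣ abc` implies polynomial abc
(`BakerShapeBound 0 1`) on all abc triples. (Everything else is `polyAbcSixteen_of_polyDegree`.)
This transfer is NOT supplied by the route's normalisation `(u⁸, v⁸ − u⁸, v⁸)`
(`DiophantineGeometry.isABCTriple_pow_eight`: `rad' ≤ 8 c⁷ rad`, useful only for exponents
`< 8/7`, cf. `DiophantineGeometry.le_of_pow_eight_le`), and no replacement is known to the author;
it is isolated here as the hypothesis. [folklore] -/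
theorem polyAbcOfPolyDegree_of_transfer
    (htransfer : (∃ κ : ℝ, ∀ a b c : ℕ, IsABCTriple a b c → 16 ∣ a * b * c →
        Real.log c ≤ κ * Real.log (rad a b c : ℕ)) → BakerShapeBound 0 1) :
    Summit.ABC.ABC.Theses.IsogenyGlueCongruence.PolyAbcOfPolyDegree := by
  intro hdeg
  exact htransfer (polyAbcSixteen_of_polyDegree hdeg)

/-- **`PolyAbcOfPolyDegree` from the degree hypothesis for ALL curves.** If the polynomial
modular-degree bound is available for every elliptic curve over `ℚ` in global minimal form (not only
the semistable ones), the filed item holds outright (`bakerShapeBound_zero_one_of_polyDegreeAll`;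
the item's own, weaker antecedent is then not needed). Recorded as the second candidate repair of
the item: widen the antecedent rather than restrict the conclusion. [folklore] -/
theorem polyAbcOfPolyDegree_of_polyDegreeAll
    (hall : ∃ κ C : ℝ, ∀ (W : WeierstrassCurve ℚ) [W.IsElliptic] [W.IsGloballyMinimal]
      [NeZero (W.conductorNorm ℤ)],
        ∃ D : ModularParametrizationData W (W.conductorNorm ℤ),
          (D.modularDegree : ℝ) ≤ C * (W.conductorNorm ℤ : ℝ) ^ κ) :
    Summit.ABC.ABC.Theses.IsogenyGlueCongruence.PolyAbcOfPolyDegree :=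
  fun _ ↦ bakerShapeBound_zero_one_of_polyDegreeAll hall

end Summit.ABC.ABC.Theorems

end
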